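import Summits.QuantumFields.BalabanUV.T4Continuum.Spine.NE1p.DressedSmallFieldOnCoresSlotLettersMass
import Summits.QuantumFields.BalabanUV.T4Continuum.Spine.NE1p.DressedSmallFieldOnCoresSlotLettersTorus

/-!
# T⁴ programme, spine estimate NE1′ (node O3b/H2) — S32 ON THE TORUS OF THE PAPERS: the slot ENDs at the core letters of record with
# (B3) in row NE5's `factorMass` CURRENCY at pv22's `tgeometry 4 N` — NO geometry hypothesis —, the ϱ-FREE sharp-room-3 form, and the
# S31 ∘ S32 commuting square in kernel (torus-then-factorMass = factorMass-then-torus)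

Cell `pub-balaban`, sub-cell `t4`, BINDER-OWNERS row NE1′ (owner lineage t4-ne1p-p1); crew seat `b2b-balaban-t4-ne1p-formalise-leaf-04`
(LEAF PROVER 04, generation 14); crew FACE row (INTENT `CLAIMS.log` 2026-08-20T18:10Z, sibling of this lineage's S31).  ADDITIVE — imports
crew rows S32 `Spine/NE1p/DressedSmallFieldOnCoresSlotLettersMass` (p229529; ⇒ S30 `DressedSmallFieldOnCoresSlotLetters` ⇒ the owner's N0r
⇒ N0q ⇒ N0p ⇒ N0o ⇒ N0m; ⇒ row NE5's `Support/B13TermCoreMass` (`factorMass`); ⇒ the substrate cell's `Support/SubstrateSlotsOfRecord`,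
`Support/SubstrateGaussianLettersBall`, `Support/SubstrateActivities`) and S31 `Spine/NE1p/DressedSmallFieldOnCoresSlotLettersTorus` (p229710;
⇒ S29, S24, pv22's `TreeLengthTorusGeometry`) ONLY; THEOREMS ONLY (+ one `example`; 0 `def`, 0 `def … : Prop`, 0 cite); nothing of S30 ∕
S31 ∕ S32 ∕ N0m–N0r ∕ S24–S29 ∕ the substrate ∕ row NE5 restated — their declarations are used BY NAME.

WHY THIS FILE.  S32 re-letters S30's (B3) binder `hM3` (one (2.38)-shape inequality per polymer on S30's EXPLICIT letters) into row NE5's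
FACTOR-MASS CURRENCY `B13TermCoreMass.factorMass` of the cores of record at a uniform margin floor `m⋆` (`hF3`; `hmq` replaced by
`(m⋆, hfloor)`) — ONE currency for the cross-row datum G-ne9p2-5 on rows NE1′ and NE5 — but keeps a GENERAL `Ge : B13Resummation.Geometry
𝔇 Cube` (clauses at `Ge.κ₀` ∕ `Ge.K₀` ∕ `Ge.ν` ∕ `Ge.c₁`, `hb : r₁·5 ≤ b₅`) and N0m §2's radius binders `hϱ` ∕ `hϱA`.  S31 put S30's
explicit-letter ENDs on pv22's CONSTRUCTED torus geometry.  THIS FILE wires both at once — the S24–S31 torus pattern verbatim, nothing else: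
* §1 at `𝔇 := tsys 4 N`, `Ge := tgeometry 4 N` (pv22), constants LOCATED AS NUMERALS by N0o `torus_consts` + S24 `K₀_four` BY NAME (ν = 9,
  κ₀ = 64·log 162, c₁ = 64, K₀ = `B12TreeDecay.K₀ 64 8`; print's (2.27) `c = 5` through `b₅ := 5·r₁`):
  `attachedPart_locE_le_of_coreLettersOf_factorMass_torus` ∕ `muPart_locE_le_of_coreLettersOf_factorMass_torus` (S32 §2 ONCE BY NAME each).
* §2 `attachedPart_locE_le_of_coreLettersOf_factorMass_printClause_three_torus` — the ϱ-FREE form (through §1 at the pencil radius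
  `ϱ⋆ := max 2 (A₀/A₁)`, `hϱ` ∕ `hϱA` ∕ `hsmall` SUPPLIED by N0m §4∕§4b's `two_le_pencilRadius` ∕ `intercept_le_pencilRadius_mul` ∕
  `pencilClause_of_printClause_three` BY NAME under a live slope `0 < A₁ ≤ A₀` and `h3 : 3·A₀·(e^{5r₁+1}·K₀(64,8)·9·64) ≤ 1` — NO radius
  binder; `hH` and `hF3`'s growth radius READ AT `ϱ⋆`, as in S29 ∕ S31).
* §3 one `example` — THE COMMUTING SQUARE IN KERNEL: §1's `attachedPart_locE_le_of_coreLettersOf_factorMass_torus` IS S31 §1's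
  `attachedPart_locE_le_of_coreLettersOf_torus` (S30's explicit-letter END on the torus) with `hmq` SUPPLIED from the floor `(m⋆, hfloor)` and
  `hM3` SUPPLIED from `hF3` through S32 §1's `sum_letterMass_le_sum_factorMass` BY NAME — S32 §2's own proof transplanted to the torus
  (torus-then-factorMass = factorMass-then-torus); NO new inequality.
Conclusions LITERALLY the crew's ONE torus currency: attached parts `≤ 4·(e·9·64·K₀(64,8)²)·A₁·e^{−r₁·torusTreeLen X₀}` (S25∕S27∕S29∕S31's
right-hand side), μ-parts `≤ e·9·64·K₀(64,8)²·A′·e^{−r₁·torusTreeLen X₀}·μ₀/(μ₁ − μ₀)` (S24∕S27∕S31's).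
CENSUS vs S32 §2 (binders): MINUS = [`𝔇`, `Cube`, `Ge`, `b₅`, `hb`] (ϱ-free form: also [`ϱ`, `hϱ`, `hϱA`, `hsmall`] ↦ [`hA₁ : 0 < A₁`,
`hle`, `h3`]); PLUS = [`N`, `[NeZero N]`]; `hF3` reads `Z.1 ⊆ X₀.1` ∕ `torusTreeLen Z.1` for `Ge.cubes Z ⊆ Ge.cubes X₀` ∕ `𝔇.dj Z`; rest
IDENTICAL.  CENSUS vs S31 §1 (the square): MINUS = [`hmq`, `hM3`]; PLUS = [`mstar`, `hmstar`, `hfloor`, `hF3`].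
WHAT STAYS DISPLAYED (binders, by name; NOTHING instantiated on Bałaban's densities): `hroom`, `0 ≤ R′ k`; per factor the substrate's
primitive letter conditions, the CENTRE CONDITIONS `hctr` and the determinant budget `hbud`; the margin FLOOR `0 < m⋆ ≤ (γ − card·ϑ·R′ k)/2`
(S32's replacement of `hmq`); `hO` ∕ `hH`; (B1b)'s residue `terms` ∕ `emb` ∕ `hscale`; (B3) = `hF3` on row NE5's `factorMass` letters of the
cores of record — G-ne9p2-5, UNPRINTED, shared with NE9 ∕ NE5, a BINDER, never `[cite:`-tagged; the located clauses «κ large»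
`r₁ + 2·(64·log 162) + 2 ≤ R` and «ε₁ small» in the SHAPES `(A₀ + ϱA₁)·E ≤ 1` ∕ `3·A₀·E ≤ 1` ∕ `A′·E ≤ 1`, `E = e^{5r₁+1}·K₀(64,8)·9·64`
((B5): the SHAPES and the factor `3` are the owner's arithmetic consumed BY NAME; their standing against print's NUMBERS is untouched).  (B4) is
discharged BY NAME on pv22's CONSTRUCTED torus geometry (pv22's READING of 𝐃_{k+1} ∕ d_{k+1}, DIVERGENCE D-pv22.3, not asserted here);
no wall item moves; the wall line v1.7 (T4-DAG v43) does NOT move; R-t4r2-Q2 NOT met thereby.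
HONEST FRAMING.  Kernel bookkeeping — by-name composition of S32 (factorMass currency) with the S24–S31 torus pattern; cores ∕ letters ∕
`actOfLetters` ∕ `coreLettersOf` ∕ `factorMass` are the cell's typed FORMAT of (2.14) and row NE5's typed mass letter, NOT Bałaban's
functions; which tables realise Bałaban's C^{(k)}(Z₀,σ), Γ_k of [Balaban1988RGII] (2.14) p. 15 is the substrate's DISPLAYED identification,
NOT claimed; printed loci ((2.14) p. 15, (2.18) p. 16, (1.26) p. 8, (2.27) ∕ (2.30) p. 18, (2.38) p. 20; [Balaban1987RGI] p. 251, p. 257) are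
TYPE ∕ CONTEXT through the imported [cite]-tagged Literature modules, re-asserted nowhere; ABSOLUTE RULE honoured ([folklore] kernel
lemmas only); no numeral of print.  NE1′ ⇐ the named binders — NOT printed, NOT proved; 0 leaves instantiated on Bałaban's densities; spine
PROVED 0∕9; count 9 unchanged.  Rung (B)+1 on ONE finite four-torus — NOT infinite volume, NOT a mass gap, NOT OS on ℝ⁴, NOT Clay.
HONEST DEPENDENCY: continuum YM on T⁴ ⇐ BetaPertH ∧ nine spine estimates (0/9 proved); BetaPertH ⇐ (D1) ∧ (D4) ∧ CAP+tail; G-an2-4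
gates asym, D1 and NE2/3/4.
-/

noncomputable section

namespace Summit.QuantumFields.BalabanUV.T4Continuum.NE1p.DressedSmallFieldOnCoresSlotLettersMassTorus

open scoped BigOperators Matrix
open Metric Set MeasureTheory
open Literature.MathematicalPhysics.QuantumFieldTheory.Balaban1983to89
open Literature.MathematicalPhysics.QuantumFieldTheory.Balaban1983to89.B13Resummation (locE)
open Literature.MathematicalPhysics.QuantumFieldTheory.Balaban1983to89.B5Prop11Lower (nsq)
open Literature.MathematicalPhysics.QuantumFieldTheory.Balaban1983to89.TreeLengthTorus (tsys torusTreeLen)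
open Literature.MathematicalPhysics.QuantumFieldTheory.Balaban1983to89.TreeLengthTorusGeometry (TTouch tgeometry)
open Literature.MathematicalPhysics.QuantumFieldTheory.Balaban1983to89.B12TreeDecay (K₀ K₀_pos)
open Summit.QuantumFields.BalabanUV.T4Continuum.B13HistMeasurable (MeasPotFrame B13HistM)
open Summit.QuantumFields.BalabanUV.T4Continuum.B13TermCoreMass (factorMass)
open Summit.QuantumFields.BalabanUV.T4Continuum.SubstrateTwoRunsDriven (DrivenRuns)
open Summit.QuantumFields.BalabanUV.T4Continuum.SubstrateActivities (coreOf actOfLetters)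
open Summit.QuantumFields.BalabanUV.T4Continuum.SubstrateGaussianLetters (gaussC gaussC_pos linForm)
open Summit.QuantumFields.BalabanUV.T4Continuum.SubstrateGaussianLettersBall (detBudget)
open Summit.QuantumFields.BalabanUV.T4Continuum.SubstrateSlotsOfRecord (ActLetters coreLettersOf)
open Summit.QuantumFields.BalabanUV.T4Continuum.NE1p.DressedSmallFieldOnCoresSlotLettersMass (sum_letterMass_le_sum_factorMass
  attachedPart_locE_le_of_coreLettersOf_factorMass muPart_locE_le_of_coreLettersOf_factorMass)
open Summit.QuantumFields.BalabanUV.T4Continuum.NE1p.DressedSmallFieldOnCoresSlotLettersTorus (attachedPart_locE_le_of_coreLettersOf_torus)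
open Summit.QuantumFields.BalabanUV.T4Continuum.NE1p.DressedSmallFieldInduction (two_le_pencilRadius intercept_le_pencilRadius_mul
  pencilClause_of_printClause_three)
open Summit.QuantumFields.BalabanUV.T4Continuum.NE1p.DressedSmallFieldGeometry (torus_consts)
open Summit.QuantumFields.BalabanUV.T4Continuum.NE1p.DressedSmallFieldGeometryFaces (K₀_four)

/- ELABORATION NOTE (instance hygiene, no mathematics; R-T123 (vii)).  As in S31: the substrate's `Support/B13Carriers` — in the cone through
S30 — registers the global instance `TwoRuns.instDecidableEqTDom`; every conclusion below therefore pins `locE (Dom := (tsys 4 N).Dom) …`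
so that instance search stays classical and the statements PRINT exactly as S29's ∕ S31's (`locE TTouch (fun Z => ↑Z) … ↑X₀`), closed by
S32's ∕ S31's ENDs BY NAME with no cast. -/

variable {G : Type} [GaugeGroup G] (D : DrivenRuns G) (P : MeasPotFrame D.carriers) {N : ℕ} [NeZero N]

variable (Op : Type) [NormedAddCommGroup Op] [NormedSpace ℂ Op] {J : Type}
  (𝒵 : D.carriers.Dom → J → Type) [∀ Z j, Fintype (𝒵 Z j)] (dom : ∀ Z j, 𝒵 Z j → D.carriers.Dom)
  (Jc : D.carriers.Dom → J → Type) [∀ Z j, Fintype (Jc Z j)]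
  (V : D.carriers.Dom → J → Type) [∀ Z j, NormedAddCommGroup (V Z j)] [∀ Z j, InnerProductSpace ℝ (V Z j)]
  [∀ Z j, MeasurableSpace (V Z j)] [∀ Z j, BorelSpace (V Z j)] [∀ Z j, FiniteDimensional ℝ (V Z j)]
  (mI : D.carriers.Dom → J → Type) [∀ Z j, Fintype (mI Z j)] [∀ Z j, DecidableEq (mI Z j)]

/-! ## §1 S32 §2's two ENDs ON THE TORUS `tgeometry 4 N` — (B3) in row NE5's `factorMass` currency, no geometry hypothesis -/

open Classical in
/-- **THE ATTACHED PART OF THE SLOT ACTIVITIES AT THE CORE LETTERS OF RECORD, (B3) IN `factorMass` CURRENCY, ON THE TORUS** (kernel; S32 §2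
`attachedPart_locE_le_of_coreLettersOf_factorMass` ONCE BY NAME at `𝔇 := tsys 4 N`, `Ge := tgeometry 4 N`, `b₅ := 5·r₁`, constants located by
N0o `torus_consts` + S24 `K₀_four`): binders = S32's with the geometry GONE (room, `0 ≤ R′`, the substrate's primitive per-factor letter
conditions, the CENTRE CONDITIONS, `hbud`, the margin FLOOR `0 < m⋆ ≤ (γ − card·ϑ·R′ k)/2`, class radii, `terms` ∕ `emb` ∕ `hscale`, the LOCATED
clauses, (B3) `hF3` on row NE5's `factorMass` letters with `Z.1 ⊆ X₀.1` and `torusTreeLen`, N0m's `hϱ` ∕ `hϱA`); bound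
`≤ 4·(e·9·64·K₀(64,8)²)·A₁·e^{−r₁·torusTreeLen X₀}` = S31 §1's. [folklore] -/
theorem attachedPart_locE_le_of_coreLettersOf_factorMass_torus {W : Set (ℕ → ℝ)}
    {ctr : ℕ → (ℕ → ℝ) → D.carriers.BgB → Op × B13HistM P}
    {ROp RHist R' : ℕ → ℝ} (A : ∀ Z j, ActLetters D P Op 𝒵 dom Jc V mI Z j) {β₀ ϑ d₀ γ : D.carriers.Dom → J → ℝ} {mstar : ℝ}
    (hroom : ∀ k, ROp k < R' k) (hR' : ∀ k, 0 ≤ R' k) (hbase : ∀ Z j ii jj, Measurable fun a => (A Z j).base a ii jj)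
    (hrdm : ∀ Z j ii jj (o' : Op), Measurable fun a => (A Z j).rd a ii jj o')
    (hβ₀ : ∀ Z j, 0 ≤ β₀ Z j) (hd₀ : ∀ Z j, 0 < d₀ Z j) (hrd : ∀ Z j a ii jj, ‖(A Z j).rd a ii jj‖ ≤ ϑ Z j)
    (hctr : ∀ k, ∀ g ∈ W, ∀ (U : D.carriers.BgB) (Z : D.carriers.Dom) (j : J) (a : (Jc Z j ⊕ 𝒵 Z j) → ℝ × ℝ),
      (∀ ii jj, ‖linForm (A Z j).base (A Z j).rd (ctr k g U).1 a ii jj‖ ≤ β₀ Z j) ∧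
      ((linForm (A Z j).base (A Z j).rd (ctr k g U).1 a).det).im = 0 ∧ d₀ Z j ≤ ((linForm (A Z j).base (A Z j).rd (ctr k g U).1 a).det).re ∧
      (∀ x : mI Z j → ℂ, γ Z j * nsq x ≤ (star x ⬝ᵥ (linForm (A Z j).base (A Z j).rd (ctr k g U).1 a *ᵥ x)).re))
    (hbud : ∀ k Z j, detBudget (Fintype.card (mI Z j)) (β₀ Z j) (ϑ Z j) (R' k) < d₀ Z j)
    (hmstar : 0 < mstar) (hfloor : ∀ k Z j, mstar ≤ (γ Z j - Fintype.card (mI Z j) * ϑ Z j * R' k) / 2)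
    {k : ℕ} {g : ℕ → ℝ} (hg : g ∈ W) {U : D.carriers.BgB} {o : Op} {h₀ w : B13HistM P} {ϱ : ℝ}
    (hO : ‖o - (ctr k g U).1‖ ≤ ROp k) (hH : ‖h₀ - (ctr k g U).2‖ + ϱ * ‖w‖ ≤ RHist k)
    {emb : (tsys 4 N).Dom → D.carriers.Dom} (hscale : ∀ Z, D.carriers.scale (emb Z) = k)
    (terms : (tsys 4 N).Dom → Finset (D.carriers.Dom × J))
    {A₀ A₁ R r₁ : ℝ} (X₀ : (tsys 4 N).Dom) (hA₀ : 0 ≤ A₀) (hA₁ : 0 ≤ A₁) (hr₁ : 0 ≤ r₁)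
    (hrate : r₁ + 2 * (64 * Real.log 162) + 2 ≤ R)
    (hsmall : (A₀ + ϱ * A₁) * Real.exp (5 * r₁ + 1) * K₀ 64 8 * 9 * 64 ≤ 1)
    (hF3 : ∀ Z : (tsys 4 N).Dom, Z.1 ⊆ X₀.1 →
      ∑ p ∈ terms Z, factorMass (fun Z j => coreOf P Op 𝒵 dom Jc V (coreLettersOf D P Op 𝒵 dom Jc V mI A) Z j)
          (fun Z j => gaussC (mI Z j) * Real.sqrt (max 1 ((Fintype.card (mI Z j)).factorial * β₀ Z j ^ Fintype.card (mI Z j) + d₀ Z j)))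
          (fun _ _ => 0) mstar (‖h₀‖ + ϱ * ‖w‖) p.1 p.2 ≤ (A₀ + ϱ * A₁) * Real.exp (-(R * torusTreeLen Z.1)))
    (hϱ : 2 ≤ ϱ) (hϱA : A₀ ≤ ϱ * A₁) :
    ‖locE (Dom := (tsys 4 N).Dom) (TTouch (d := 4) (N := N)) (fun Z : (tsys 4 N).Dom => Z.1) (fun Z => ∑ p ∈ terms Z,
          actOfLetters P Op 𝒵 dom Jc V (coreLettersOf D P Op 𝒵 dom Jc V mI A) p.1 p.2 o (h₀ + w)) X₀.1 -
        locE (Dom := (tsys 4 N).Dom) (TTouch (d := 4) (N := N)) (fun Z : (tsys 4 N).Dom => Z.1) (fun Z => ∑ p ∈ terms Z,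
          actOfLetters P Op 𝒵 dom Jc V (coreLettersOf D P Op 𝒵 dom Jc V mI A) p.1 p.2 o h₀) X₀.1‖ ≤
      4 * (Real.exp 1 * 9 * 64 * K₀ 64 8 ^ 2) * A₁ * Real.exp (-(r₁ * torusTreeLen X₀.1)) := by
  obtain ⟨hν, hκ, hc⟩ := torus_consts N
  have h := attachedPart_locE_le_of_coreLettersOf_factorMass D P Op 𝒵 dom Jc V mI (tsys 4 N) (tgeometry 4 N) A hroom hR' hbase hrdm
    hβ₀ hd₀ hrd hctr hbud hmstar hfloor hg hO hH hscale terms (R := R) (b₅ := 5 * r₁) (X₀ := X₀) hA₀ hA₁ hr₁ (le_of_eq (by ring))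
    (by rw [hκ]; exact hrate) (by rw [K₀_four, hν, hc]; exact hsmall) hF3 hϱ hϱA
  rw [hν, hc, K₀_four] at h
  exact h

open Classical in
/-- **THE μ-PART OF THE SAME, (B3) IN `factorMass` CURRENCY, ON THE TORUS** (kernel; S32 §2 `muPart_locE_le_of_coreLettersOf_factorMass` ONCE
BY NAME at `tgeometry 4 N`): SOURCE pencil `h₀ + s • v`, `0 < μ₀ < μ₁`, `‖sμ‖ ≤ μ₀`, `hF3` at the history radius `‖h₀‖ + μ₁‖v‖` and budget
`A′`, `hH` at `μ₁`; bound = S24∕S27∕S31's μ-part currency. [folklore] -/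
theorem muPart_locE_le_of_coreLettersOf_factorMass_torus {W : Set (ℕ → ℝ)}
    {ctr : ℕ → (ℕ → ℝ) → D.carriers.BgB → Op × B13HistM P}
    {ROp RHist R' : ℕ → ℝ} (A : ∀ Z j, ActLetters D P Op 𝒵 dom Jc V mI Z j) {β₀ ϑ d₀ γ : D.carriers.Dom → J → ℝ} {mstar : ℝ}
    (hroom : ∀ k, ROp k < R' k) (hR' : ∀ k, 0 ≤ R' k) (hbase : ∀ Z j ii jj, Measurable fun a => (A Z j).base a ii jj)
    (hrdm : ∀ Z j ii jj (o' : Op), Measurable fun a => (A Z j).rd a ii jj o')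
    (hβ₀ : ∀ Z j, 0 ≤ β₀ Z j) (hd₀ : ∀ Z j, 0 < d₀ Z j) (hrd : ∀ Z j a ii jj, ‖(A Z j).rd a ii jj‖ ≤ ϑ Z j)
    (hctr : ∀ k, ∀ g ∈ W, ∀ (U : D.carriers.BgB) (Z : D.carriers.Dom) (j : J) (a : (Jc Z j ⊕ 𝒵 Z j) → ℝ × ℝ),
      (∀ ii jj, ‖linForm (A Z j).base (A Z j).rd (ctr k g U).1 a ii jj‖ ≤ β₀ Z j) ∧
      ((linForm (A Z j).base (A Z j).rd (ctr k g U).1 a).det).im = 0 ∧ d₀ Z j ≤ ((linForm (A Z j).base (A Z j).rd (ctr k g U).1 a).det).re ∧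
      (∀ x : mI Z j → ℂ, γ Z j * nsq x ≤ (star x ⬝ᵥ (linForm (A Z j).base (A Z j).rd (ctr k g U).1 a *ᵥ x)).re))
    (hbud : ∀ k Z j, detBudget (Fintype.card (mI Z j)) (β₀ Z j) (ϑ Z j) (R' k) < d₀ Z j)
    (hmstar : 0 < mstar) (hfloor : ∀ k Z j, mstar ≤ (γ Z j - Fintype.card (mI Z j) * ϑ Z j * R' k) / 2)
    {k : ℕ} {g : ℕ → ℝ} (hg : g ∈ W) {U : D.carriers.BgB} {o : Op} {h₀ v : B13HistM P} {μ₁ : ℝ}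
    (hO : ‖o - (ctr k g U).1‖ ≤ ROp k) (hH : ‖h₀ - (ctr k g U).2‖ + μ₁ * ‖v‖ ≤ RHist k)
    {emb : (tsys 4 N).Dom → D.carriers.Dom} (hscale : ∀ Z, D.carriers.scale (emb Z) = k)
    (terms : (tsys 4 N).Dom → Finset (D.carriers.Dom × J))
    {A' R r₁ μ₀ : ℝ} (X₀ : (tsys 4 N).Dom) {sμ : ℂ} (hA : 0 ≤ A') (hr₁ : 0 ≤ r₁)
    (hrate : r₁ + 2 * (64 * Real.log 162) + 2 ≤ R) (hsmall : A' * Real.exp (5 * r₁ + 1) * K₀ 64 8 * 9 * 64 ≤ 1)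
    (hF3 : ∀ Z : (tsys 4 N).Dom, Z.1 ⊆ X₀.1 →
      ∑ p ∈ terms Z, factorMass (fun Z j => coreOf P Op 𝒵 dom Jc V (coreLettersOf D P Op 𝒵 dom Jc V mI A) Z j)
          (fun Z j => gaussC (mI Z j) * Real.sqrt (max 1 ((Fintype.card (mI Z j)).factorial * β₀ Z j ^ Fintype.card (mI Z j) + d₀ Z j)))
          (fun _ _ => 0) mstar (‖h₀‖ + μ₁ * ‖v‖) p.1 p.2 ≤ A' * Real.exp (-(R * torusTreeLen Z.1)))
    (h0 : 0 < μ₀) (h01 : μ₀ < μ₁) (hμ : ‖sμ‖ ≤ μ₀) :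
    ‖locE (Dom := (tsys 4 N).Dom) (TTouch (d := 4) (N := N)) (fun Z : (tsys 4 N).Dom => Z.1) (fun Z => ∑ p ∈ terms Z,
          actOfLetters P Op 𝒵 dom Jc V (coreLettersOf D P Op 𝒵 dom Jc V mI A) p.1 p.2 o (h₀ + sμ • v)) X₀.1 -
        locE (Dom := (tsys 4 N).Dom) (TTouch (d := 4) (N := N)) (fun Z : (tsys 4 N).Dom => Z.1) (fun Z => ∑ p ∈ terms Z,
          actOfLetters P Op 𝒵 dom Jc V (coreLettersOf D P Op 𝒵 dom Jc V mI A) p.1 p.2 o h₀) X₀.1‖ ≤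
      Real.exp 1 * 9 * 64 * K₀ 64 8 ^ 2 * A' * Real.exp (-(r₁ * torusTreeLen X₀.1)) * (μ₀ / (μ₁ - μ₀)) := by
  obtain ⟨hν, hκ, hc⟩ := torus_consts N
  have h := muPart_locE_le_of_coreLettersOf_factorMass D P Op 𝒵 dom Jc V mI (tsys 4 N) (tgeometry 4 N) A hroom hR' hbase hrdm hβ₀
    hd₀ hrd hctr hbud hmstar hfloor hg hO hH hscale terms (R := R) (b₅ := 5 * r₁) (X₀ := X₀) (sμ := sμ) hA hr₁ (le_of_eq (by ring))
    (by rw [hκ]; exact hrate) (by rw [K₀_four, hν, hc]; exact hsmall) hF3 h0 h01 hμ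
  rw [hν, hc, K₀_four] at h
  exact h

/-! ## §2 The ϱ-FREE form — no geometry hypothesis, no radius binder (N0m §4∕§4b's arithmetic BY NAME, sharp room 3) -/

open Classical in
/-- **THE SAME ATTACHED PART, ϱ-FREE, (B3) IN `factorMass` CURRENCY** (kernel; §1 `attachedPart_locE_le_of_coreLettersOf_factorMass_torus` at
`ϱ⋆ := max 2 (A₀/A₁)`, its `hϱ` ∕ `hϱA` ∕ `hsmall` SUPPLIED by N0m §4∕§4b's `two_le_pencilRadius` ∕ `intercept_le_pencilRadius_mul` ∕
`pencilClause_of_printClause_three` BY NAME — S29 ∕ S31's pattern): live slope `0 < A₁ ≤ A₀`, «κ large», «ε₁ small with the sharp factor-3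
room» `3·A₀·(e^{5r₁+1}·K₀(64,8)·9·64) ≤ 1`, `hH` and `hF3`'s growth radius READ AT `ϱ⋆` ⇒ the same bound. [folklore] -/
theorem attachedPart_locE_le_of_coreLettersOf_factorMass_printClause_three_torus {W : Set (ℕ → ℝ)}
    {ctr : ℕ → (ℕ → ℝ) → D.carriers.BgB → Op × B13HistM P}
    {ROp RHist R' : ℕ → ℝ} (A : ∀ Z j, ActLetters D P Op 𝒵 dom Jc V mI Z j) {β₀ ϑ d₀ γ : D.carriers.Dom → J → ℝ} {mstar : ℝ}
    (hroom : ∀ k, ROp k < R' k) (hR' : ∀ k, 0 ≤ R' k) (hbase : ∀ Z j ii jj, Measurable fun a => (A Z j).base a ii jj)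
    (hrdm : ∀ Z j ii jj (o' : Op), Measurable fun a => (A Z j).rd a ii jj o')
    (hβ₀ : ∀ Z j, 0 ≤ β₀ Z j) (hd₀ : ∀ Z j, 0 < d₀ Z j) (hrd : ∀ Z j a ii jj, ‖(A Z j).rd a ii jj‖ ≤ ϑ Z j)
    (hctr : ∀ k, ∀ g ∈ W, ∀ (U : D.carriers.BgB) (Z : D.carriers.Dom) (j : J) (a : (Jc Z j ⊕ 𝒵 Z j) → ℝ × ℝ),
      (∀ ii jj, ‖linForm (A Z j).base (A Z j).rd (ctr k g U).1 a ii jj‖ ≤ β₀ Z j) ∧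
      ((linForm (A Z j).base (A Z j).rd (ctr k g U).1 a).det).im = 0 ∧ d₀ Z j ≤ ((linForm (A Z j).base (A Z j).rd (ctr k g U).1 a).det).re ∧
      (∀ x : mI Z j → ℂ, γ Z j * nsq x ≤ (star x ⬝ᵥ (linForm (A Z j).base (A Z j).rd (ctr k g U).1 a *ᵥ x)).re))
    (hbud : ∀ k Z j, detBudget (Fintype.card (mI Z j)) (β₀ Z j) (ϑ Z j) (R' k) < d₀ Z j)
    (hmstar : 0 < mstar) (hfloor : ∀ k Z j, mstar ≤ (γ Z j - Fintype.card (mI Z j) * ϑ Z j * R' k) / 2)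
    {k : ℕ} {g : ℕ → ℝ} (hg : g ∈ W) {U : D.carriers.BgB} {o : Op} {h₀ w : B13HistM P} {A₀ A₁ : ℝ}
    (hO : ‖o - (ctr k g U).1‖ ≤ ROp k) (hH : ‖h₀ - (ctr k g U).2‖ + max 2 (A₀ / A₁) * ‖w‖ ≤ RHist k)
    {emb : (tsys 4 N).Dom → D.carriers.Dom} (hscale : ∀ Z, D.carriers.scale (emb Z) = k)
    (terms : (tsys 4 N).Dom → Finset (D.carriers.Dom × J))
    {R r₁ : ℝ} (X₀ : (tsys 4 N).Dom) (hA₀ : 0 ≤ A₀) (hA₁ : 0 < A₁) (hle : A₁ ≤ A₀) (hr₁ : 0 ≤ r₁)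
    (hrate : r₁ + 2 * (64 * Real.log 162) + 2 ≤ R) (h3 : 3 * A₀ * (Real.exp (5 * r₁ + 1) * K₀ 64 8 * 9 * 64) ≤ 1)
    (hF3 : ∀ Z : (tsys 4 N).Dom, Z.1 ⊆ X₀.1 →
      ∑ p ∈ terms Z, factorMass (fun Z j => coreOf P Op 𝒵 dom Jc V (coreLettersOf D P Op 𝒵 dom Jc V mI A) Z j)
          (fun Z j => gaussC (mI Z j) * Real.sqrt (max 1 ((Fintype.card (mI Z j)).factorial * β₀ Z j ^ Fintype.card (mI Z j) + d₀ Z j)))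
          (fun _ _ => 0) mstar (‖h₀‖ + max 2 (A₀ / A₁) * ‖w‖) p.1 p.2 ≤
        (A₀ + max 2 (A₀ / A₁) * A₁) * Real.exp (-(R * torusTreeLen Z.1))) :
    ‖locE (Dom := (tsys 4 N).Dom) (TTouch (d := 4) (N := N)) (fun Z : (tsys 4 N).Dom => Z.1) (fun Z => ∑ p ∈ terms Z,
          actOfLetters P Op 𝒵 dom Jc V (coreLettersOf D P Op 𝒵 dom Jc V mI A) p.1 p.2 o (h₀ + w)) X₀.1 -
        locE (Dom := (tsys 4 N).Dom) (TTouch (d := 4) (N := N)) (fun Z : (tsys 4 N).Dom => Z.1) (fun Z => ∑ p ∈ terms Z,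
          actOfLetters P Op 𝒵 dom Jc V (coreLettersOf D P Op 𝒵 dom Jc V mI A) p.1 p.2 o h₀) X₀.1‖ ≤
      4 * (Real.exp 1 * 9 * 64 * K₀ 64 8 ^ 2) * A₁ * Real.exp (-(r₁ * torusTreeLen X₀.1)) := by
  have hE : 0 ≤ Real.exp (5 * r₁ + 1) * K₀ 64 8 * 9 * 64 :=
    mul_nonneg (mul_nonneg (mul_nonneg (Real.exp_nonneg _) (K₀_pos 64 8).le) (by norm_num)) (by norm_num)
  have hsmall : (A₀ + max 2 (A₀ / A₁) * A₁) * Real.exp (5 * r₁ + 1) * K₀ 64 8 * 9 * 64 ≤ 1 := by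
    simpa only [mul_assoc] using pencilClause_of_printClause_three hA₁ hle hE h3
  exact attachedPart_locE_le_of_coreLettersOf_factorMass_torus D P Op 𝒵 dom Jc V mI A hroom hR' hbase hrdm hβ₀ hd₀ hrd hctr hbud
    hmstar hfloor hg hO hH hscale terms X₀ hA₀ hA₁.le hr₁ hrate hsmall hF3 (two_le_pencilRadius A₀ A₁) (intercept_le_pencilRadius_mul hA₁)

/-! ## §3 Consistency — THE S31 ∘ S32 SQUARE COMMUTES, in kernel (torus-then-factorMass = factorMass-then-torus) -/

open Classical in
/-- (E) THE COMMUTING SQUARE: §1's `attachedPart_locE_le_of_coreLettersOf_factorMass_torus` IS S31 §1's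
`attachedPart_locE_le_of_coreLettersOf_torus` (S30's explicit-letter END on the torus) with `hmq` SUPPLIED from the margin floor `(m⋆, hfloor)`
and `hM3` SUPPLIED from `hF3` through S32 §1's `sum_letterMass_le_sum_factorMass` BY NAME — S32 §2's own proof transplanted to the torus; NO
new inequality. [folklore] -/
example {W : Set (ℕ → ℝ)} {ctr : ℕ → (ℕ → ℝ) → D.carriers.BgB → Op × B13HistM P}
    {ROp RHist R' : ℕ → ℝ} (A : ∀ Z j, ActLetters D P Op 𝒵 dom Jc V mI Z j) {β₀ ϑ d₀ γ : D.carriers.Dom → J → ℝ} {mstar : ℝ}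
    (hroom : ∀ k, ROp k < R' k) (hR' : ∀ k, 0 ≤ R' k) (hbase : ∀ Z j ii jj, Measurable fun a => (A Z j).base a ii jj)
    (hrdm : ∀ Z j ii jj (o' : Op), Measurable fun a => (A Z j).rd a ii jj o')
    (hβ₀ : ∀ Z j, 0 ≤ β₀ Z j) (hd₀ : ∀ Z j, 0 < d₀ Z j) (hrd : ∀ Z j a ii jj, ‖(A Z j).rd a ii jj‖ ≤ ϑ Z j)
    (hctr : ∀ k, ∀ g ∈ W, ∀ (U : D.carriers.BgB) (Z : D.carriers.Dom) (j : J) (a : (Jc Z j ⊕ 𝒵 Z j) → ℝ × ℝ),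
      (∀ ii jj, ‖linForm (A Z j).base (A Z j).rd (ctr k g U).1 a ii jj‖ ≤ β₀ Z j) ∧
      ((linForm (A Z j).base (A Z j).rd (ctr k g U).1 a).det).im = 0 ∧ d₀ Z j ≤ ((linForm (A Z j).base (A Z j).rd (ctr k g U).1 a).det).re ∧
      (∀ x : mI Z j → ℂ, γ Z j * nsq x ≤ (star x ⬝ᵥ (linForm (A Z j).base (A Z j).rd (ctr k g U).1 a *ᵥ x)).re))
    (hbud : ∀ k Z j, detBudget (Fintype.card (mI Z j)) (β₀ Z j) (ϑ Z j) (R' k) < d₀ Z j)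
    (hmstar : 0 < mstar) (hfloor : ∀ k Z j, mstar ≤ (γ Z j - Fintype.card (mI Z j) * ϑ Z j * R' k) / 2)
    {k : ℕ} {g : ℕ → ℝ} (hg : g ∈ W) {U : D.carriers.BgB} {o : Op} {h₀ w : B13HistM P} {ϱ : ℝ}
    (hO : ‖o - (ctr k g U).1‖ ≤ ROp k) (hH : ‖h₀ - (ctr k g U).2‖ + ϱ * ‖w‖ ≤ RHist k)
    {emb : (tsys 4 N).Dom → D.carriers.Dom} (hscale : ∀ Z, D.carriers.scale (emb Z) = k)
    (terms : (tsys 4 N).Dom → Finset (D.carriers.Dom × J))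
    {A₀ A₁ R r₁ : ℝ} (X₀ : (tsys 4 N).Dom) (hA₀ : 0 ≤ A₀) (hA₁ : 0 ≤ A₁) (hr₁ : 0 ≤ r₁)
    (hrate : r₁ + 2 * (64 * Real.log 162) + 2 ≤ R)
    (hsmall : (A₀ + ϱ * A₁) * Real.exp (5 * r₁ + 1) * K₀ 64 8 * 9 * 64 ≤ 1)
    (hF3 : ∀ Z : (tsys 4 N).Dom, Z.1 ⊆ X₀.1 →
      ∑ p ∈ terms Z, factorMass (fun Z j => coreOf P Op 𝒵 dom Jc V (coreLettersOf D P Op 𝒵 dom Jc V mI A) Z j)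
          (fun Z j => gaussC (mI Z j) * Real.sqrt (max 1 ((Fintype.card (mI Z j)).factorial * β₀ Z j ^ Fintype.card (mI Z j) + d₀ Z j)))
          (fun _ _ => 0) mstar (‖h₀‖ + ϱ * ‖w‖) p.1 p.2 ≤ (A₀ + ϱ * A₁) * Real.exp (-(R * torusTreeLen Z.1)))
    (hϱ : 2 ≤ ϱ) (hϱA : A₀ ≤ ϱ * A₁) :
    ‖locE (Dom := (tsys 4 N).Dom) (TTouch (d := 4) (N := N)) (fun Z : (tsys 4 N).Dom => Z.1) (fun Z => ∑ p ∈ terms Z,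
          actOfLetters P Op 𝒵 dom Jc V (coreLettersOf D P Op 𝒵 dom Jc V mI A) p.1 p.2 o (h₀ + w)) X₀.1 -
        locE (Dom := (tsys 4 N).Dom) (TTouch (d := 4) (N := N)) (fun Z : (tsys 4 N).Dom => Z.1) (fun Z => ∑ p ∈ terms Z,
          actOfLetters P Op 𝒵 dom Jc V (coreLettersOf D P Op 𝒵 dom Jc V mI A) p.1 p.2 o h₀) X₀.1‖ ≤
      4 * (Real.exp 1 * 9 * 64 * K₀ 64 8 ^ 2) * A₁ * Real.exp (-(r₁ * torusTreeLen X₀.1)) :=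
  attachedPart_locE_le_of_coreLettersOf_torus D P Op 𝒵 dom Jc V mI A hroom hR' hbase hrdm hβ₀ hd₀ hrd hctr hbud
    (fun k Z j => by have h := hfloor k Z j; linarith) hg hO hH hscale terms X₀ hA₀ hA₁ hr₁ hrate hsmall
    (fun Z hZ => le_trans (sum_letterMass_le_sum_factorMass
      (fun Z j => coreOf P Op 𝒵 dom Jc V (coreLettersOf D P Op 𝒵 dom Jc V mI A) Z j)
      (N₀f := fun Z j => gaussC (mI Z j) * Real.sqrt (max 1 ((Fintype.card (mI Z j)).factorial * β₀ Z j ^ Fintype.card (mI Z j) + d₀ Z j)))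
      (R₀ := ‖h₀‖ + ϱ * ‖w‖) (mq := fun p => (γ p.1 p.2 - Fintype.card (mI p.1 p.2) * ϑ p.1 p.2 * R' k) / 2) (terms Z) hmstar
      (fun p _ => hfloor k p.1 p.2)
      (fun Z j => (norm_nonneg _).trans ((coreOf P Op 𝒵 dom Jc V (coreLettersOf D P Op 𝒵 dom Jc V mI A) Z j).norm_w_le fun _ => (0, 0)))
      (fun Z j => mul_nonneg gaussC_pos.le (Real.sqrt_nonneg _))) (hF3 Z hZ))
    hϱ hϱA

end Summit.QuantumFields.BalabanUV.T4Continuum.NE1p.DressedSmallFieldOnCoresSlotLettersMassTorus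

end
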